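import Literature.IUT.LogThetaLattice.PacketLogVolumesHaarModelCapsulePortions
import Literature.IUT.LogThetaLattice.PacketWeights
import HarnessLib

/-!
# [IUTchIII] Proposition 3.9 (i)/(iii) for CAPSULES at the genuine model, II: the `A`-packet log-volume
# `μ^log_{A,v_ℚ}` (Remark 3.1.1 (ii) weights over the portions), the global log-volume `μ^log_{A,𝕍_ℚ}` and its
# invariance under `F^×` acting on any label — `Prop39iii_invariance` for EVERY finite label set `A` and EVERY
# number field `F` (abc-iut cell, layer L6, row «CAP39» = residual R-iii-tensor of plan/L6/SUBDAG-IUTchIII-Prop-39.md;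
# the assembly of record per abc-iut-L6-lead §F v1.18q)

S. Mochizuki, *Inter-universal Teichmüller theory III*, kurims manuscript (May 2020), §3 [claim: Mochizuki2012,
status: disputed]. Remark 3.1.1 (ii), p. 94: "when we consider log-volumes on the portion of `log(^A𝓕_{v_ℚ})`
corresponding to the tensor product of various `K_{v_α}` … it will be necessary to consider these log-volumes
relative to the weight `1/∏_{α∈A}[K_{v_α}:(F_mod)_{v_α}]` … When, moreover, we consider direct sums over all
possible choices for the data `{v_α}_{α∈A}`, it will be convenient to use the normalized weight
`1/((∏_{α∈A}[K_{v_α}:(F_mod)_{v_α}])·{Σ_{{w_α}_{α∈A}} ∏_{α∈A}[(F_mod)_{w_α}:ℚ_{v_ℚ}]})` … normalized so that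
multiplication by `p_{v_ℚ}` affects log-volumes by addition or subtraction … of the quantity `log(p_{v_ℚ})`".
Proposition 3.9 (i), p. 115: "log-volumes `μ^log_{A,v_ℚ} : 𝕄(𝓘^ℚ(^A𝓕_{v_ℚ})) → ℝ`"; (iii), p. 117: "by adding the
log-volumes of (i) [all but finitely many of which are zero!] at the various `v_ℚ ∈ 𝕍_ℚ`, one obtains a global
log-volume `μ^log_{A,𝕍_ℚ} : 𝕄(𝓘^ℚ(^A𝓕_{𝕍_ℚ})) → ℝ` which is invariant with respect to multiplication by
elements of `(†𝕄⊛_mod)_α = (†𝕄⊛_MOD)_α ⊆ 𝓘^ℚ(^A𝓕_{𝕍_ℚ})`".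

WHAT THIS FILE ADDS (over `PacketLogVolumesHaarModelCapsulePortions.lean`: the portions `⊗_{α}F_{v_α}` /
`⊗_{α,ℝ}ℂ` with their Haar log-volumes `μ^log` normalised by the dimension, and the shifts `(1/n_{v_α})·log‖f‖_{v_α}`
/ `log|f|_{w_α}` under `f ∈ F^×` on the label `α`). For `K = F_mod = F` and any finite nonempty label set `A`:
* `placeProbWeight F v` — the weight of ONE place in the dimension-normalised convention: `n_v/[F:ℚ]` at a finite
  `v` (`n_v = e_v f_v`), `[F_w:ℝ]/[F:ℚ]` at an archimedean `w`; they sum to `1` over every packet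
  (`sum_packet_placeProbWeight`: `Σ_{v|p} n_v = [F:ℚ]`, `Σ_{w|∞}[F_w:ℝ] = [F:ℚ]`), and
  `placeProbWeight F v · θ_v(f) = haarWeight F v · log‖f‖_v` (`placeProbWeight_mul_placeLogModulus`) — the summand
  of p415871's product formula `finsum_logModulus_eq_zero`;
* `portionWeight F A q π = ∏_α placeProbWeight F (π α)` — the weight of the portion `π = (v_α)_α`; at a finite
  `v_ℚ = p` this IS Remark 3.1.1 (ii)'s normalized weight `1/[F:ℚ]^{|A|}` times the dimension `∏_α n_{v_α}` that the
  companion's `μ^log` divides by (**`portionWeight_prime_eq_packetWeightTensor_mul`**, abc-iut-L6-t4's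
  `packetWeightTensor` with `[K_v:(F_mod)_v] = 1`), i.e. printed weight × printed (un-normalised) log-volume =
  `portionWeight × tensorLogVolume` portion by portion;
* **`capsulePacketLogVolume F A q`** = `μ^log_{A,v_ℚ}` of Prop. 3.9 (i) on GENUINE regions (a family, over the portions
  `π`, of admissible subsets of `⊗_α F_{v_α}` resp. `⊗_{α,ℝ}ℂ`), `capsulePacketLogModulus F A α f q` = its change under
  `f` on the label `α`, and **`capsulePacketLogModulus_eq_packetLogModulus`: that change is `Σ_{v|v_ℚ} c_v·log‖f‖_v`**,
  the `|A| = 1` change of p415871, for EVERY `A` and every label (`sum_pi_prod_mul_apply`: `Σ_π (∏_β ω(π β))·g(π α)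
  = Σ_v ω(v)·g(v)` when `Σ ω = 1`) — the kernel form of abc-iut-w4-d035's finding d035-F1 / abc-iut-L6-d3's
  `capsuleLogVolume₁` at the genuine model;
* `capsulePacketAction F A α f` on global regions and **`prop39iii_invariance_haarModelCapsules_general F A α :
  Prop39iii_invariance (capsulePacketLogVolume F A) (capsulePacketAction F A α)`** — the printed invariance clause
  HOLDS at the genuine `A`-packets for every label `α ∈ A`: abc-iut-L6-t5's `Prop39iii_invariance_of_productFormula`
  fed with the local law and p415871's product formula `finsum_packetLogModulus_eq_zero`.

PARALLEL ENCODING (abc-iut-w5-d223, p418422 `PacketLogVolumesHaarModelCapsulesNonarch.lean` + p418734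
`PacketLogVolumesHaarModelCapsules.lean`, landed minutes earlier on the path first named for this file): the same
mathematics with the WHOLE archimedean packet `⊗_{α} ⊕_{w|∞} ℂ` of abc-iut-L5-t7 at once and uniform averaging over
its canonical coordinates, hence its closing theorem `prop39iii_invariance_haarModelCapsules` carries the hypothesis
`htc : ∀ w, w.IsComplex` (`F` totally complex, the IUT case). THIS file's portion-by-portion weights `∏_α [F_{w_α}:ℝ]/[F:ℚ]`
need no such hypothesis: `prop39iii_invariance_haarModelCapsules_general` holds for every number field `F`; for totally
complex `F` the two encodings agree weight by weight (`[F_w:ℝ] = 2` for all `w`). Distinct path and names by the lead's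
ruling (§F v1.18o/q) and d223's fix (a); nothing of p418422/p418734 is restated or imported here.

HONEST SCOPE. As the companion: `K = F_mod = F`; `⊗_ℝ` of copies of `ℂ` at every archimedean tuple (faithful for
totally complex `F`); regions = all positive-finite-volume subsets; the DEGREE clause for capsules stays at the
divisor-level model `prop39iii_degree_capsuleModel₁` (p412326) — its genuine-region version needs the compactness
`p^{d_I}(R_I)^∼ ⊆ R_I` of [IUTchIV] Prop. 1.1 for the normalising constant and is not typed here. Nothing here
constructs `(†𝓕⊛_mod)_α`, asserts anything about [IUTchIII] Cor. 3.12, or takes a side; typed ≠ endorsed.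
Classical mathematics (Haar measure, the product formula). [cite: DupuyHilado2025, §3.7]
-/

noncomputable section

namespace Literature.IUT.LogThetaLattice

open Literature.IUT.LogVolume Literature.NumberTheory.NumberFields NumberField IsDedekindDomain MeasureTheory Set
open scoped ENNReal NNReal

variable (F : Type) [Field F] [NumberField F]
variable (A : Type) [Fintype A] [DecidableEq A] [Nonempty A]

/-! ### Per-place weights and log-moduli in the dimension-normalised convention -/

/-- The weight of ONE place when log-volumes are normalised by the `ℚ_{v_ℚ}`-dimension (campaign-S
`tensorLogVolume` / `packetLogVol`): `n_v/[F:ℚ]` at a finite `v`, `[F_w:ℝ]/[F:ℚ]` at an archimedean `w` — Remark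
3.1.1 (ii)'s normalized weight `1/[F:ℚ]` (`K = F_mod`) multiplied by the dimension `[F_v:ℚ_{v_ℚ}]` the normalised
log-volume divides by. [claim: Mochizuki2012, status: disputed] -/
def placeProbWeight : Place F → ℝ :=
  Sum.elim (fun w => (w.mult : ℝ) / Module.finrank ℚ F) (fun v => (localDegree F v : ℝ) / Module.finrank ℚ F)

/-- `placeProbWeight (inl w) = [F_w:ℝ]/[F:ℚ]`. [claim: Mochizuki2012, status: disputed] -/
@[simp] theorem placeProbWeight_inl (w : InfinitePlace F) :
    placeProbWeight F (Sum.inl w) = (w.mult : ℝ) / Module.finrank ℚ F := rfl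

/-- `placeProbWeight (inr v) = n_v/[F:ℚ]`. [claim: Mochizuki2012, status: disputed] -/
@[simp] theorem placeProbWeight_inr (v : HeightOneSpectrum (𝓞 F)) :
    placeProbWeight F (Sum.inr v) = (localDegree F v : ℝ) / Module.finrank ℚ F := rfl

/-- The log-modulus of `f ∈ F^×` at ONE place in the dimension-normalised convention: `log|f|_w` at an
archimedean `w`, `(1/n_v)·log‖f‖_v` at a finite `v` (the shifts of the companion's portions,
`archPortion_shift` / `nonarchPortion_shift`). [claim: Mochizuki2012, status: disputed] -/
def placeLogModulus (f : Fˣ) : Place F → ℝ :=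
  Sum.elim (fun w => Real.log (w (f : F)))
    (fun v => Real.log (NumberField.HeightOneSpectrum.adicAbv F v (f : F)) / localDegree F v)

/-- **Weight × modulus is p415871's summand**: `placeProbWeight F v · θ_v(f) = haarWeight F v · log‖f‖_v` at every
place (`(n_v/[F:ℚ])·(log‖f‖_v/n_v) = (1/[F:ℚ])·log‖f‖_v`). [claim: Mochizuki2012, status: disputed] -/
theorem placeProbWeight_mul_placeLogModulus (f : Fˣ) (v : Place F) :
    placeProbWeight F v * placeLogModulus F f v = haarWeight F v * Real.log ((placeDatum F v).modulus (f : F)) := by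
  rcases v with w | v
  · simp [placeProbWeight, placeLogModulus]
  · simp only [placeProbWeight_inr, placeLogModulus, Sum.elim_inr, placeDatum_inr, nonarchDatum_modulus,
      haarWeight_inr]
    have hn : (localDegree F v : ℝ) ≠ 0 := by exact_mod_cast (localDegree_pos F v).ne'
    field_simp

/-- **The weights of a packet sum to `1`**: `Σ_{w|∞}[F_w:ℝ]/[F:ℚ] = 1` (Mathlib `InfinitePlace.sum_mult_eq`) and
`Σ_{v|p} n_v/[F:ℚ] = 1` (the fundamental identity `Σ_{v|p} e_v f_v = [F:ℚ]`, campaign-S `sum_localDegree`) — the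
packet-normalisations "`×e ↦ +log e`", "`×p ↦ −log p`" of Prop. 3.9 (i). [claim: Mochizuki2012, status: disputed] -/
theorem sum_packet_placeProbWeight (q : RatPlace) : ∑ v : Packet F q, placeProbWeight F v.1 = 1 := by
  have hd : (Module.finrank ℚ F : ℝ) ≠ 0 := (FinDivisor.finrank_pos (F := F)).ne'
  rcases q with ⟨⟩ | p
  · have h := sum_haarWeight_arch F
    rw [sum_packet_infty]
    simpa only [placeProbWeight_inl, haarWeight_inl] using h
  · haveI : Fact (p : ℕ).Prime := ⟨p.2⟩
    rw [sum_packet_prime]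
    simp only [placeProbWeight_inr]
    rw [← Finset.sum_div, ← Nat.cast_sum, sum_localDegree F (p : ℕ), div_self hd]

/-! ### Summing a product weight against a function of one coordinate -/

omit [Nonempty A] in
/-- **`Σ_{π : A → W} (∏_β ω(π β))·g(π α) = Σ_w ω(w)·g(w)`** for weights with `Σ_w ω(w) = 1`: the only elementary
identity behind the label-additivity of the capsule log-volume (abc-iut-w4-d035's d035-F1 in product-weight form).
[claim: Mochizuki2012, status: disputed] -/
theorem sum_pi_prod_mul_apply {W : Type} [Fintype W] (ω g : W → ℝ) (hω : ∑ w, ω w = 1) (α : A) :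
    ∑ π : A → W, (∏ β, ω (π β)) * g (π α) = ∑ w, ω w * g w := by
  classical
  have h1 : ∀ π : A → W, (∏ β, ω (π β)) * g (π α) =
      ∏ β, (if β = α then ω (π β) * g (π β) else ω (π β)) := by
    intro π
    have h : ∀ β, (if β = α then ω (π β) * g (π β) else ω (π β)) =
        ω (π β) * (if β = α then g (π β) else 1) := by
      intro β
      split_ifs <;> simp
    simp_rw [h]
    rw [Finset.prod_mul_distrib, Finset.prod_ite_eq' Finset.univ α (fun β => g (π β)), if_pos (Finset.mem_univ α)]
  simp_rw [h1]
  rw [← Fintype.prod_sum (fun β w => if β = α then ω w * g w else ω w)]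
  have h2 : ∀ β : A, (∑ w, (if β = α then ω w * g w else ω w)) = if β = α then ∑ w, ω w * g w else 1 := by
    intro β
    split_ifs <;> simp [hω]
  simp_rw [h2]
  rw [Finset.prod_ite_eq' Finset.univ α (fun _ => ∑ w, ω w * g w), if_pos (Finset.mem_univ α)]

/-! ### The portions of the `A`-packet at `v_ℚ` and the capsule log-volume `μ^log_{A,v_ℚ}` -/

/-- The portions of the `A`-packet at `v_ℚ`: tuples `π = (v_α)_{α∈A}` of places of `F` over `v_ℚ` (Remark 3.1.1
(ii) "all possible choices for the data `{v_α}_{α∈A}`"; Prop. 3.1: `log(^A𝓕_{v_ℚ}) = ⊗_α ⊕_{v|v_ℚ} log(^α𝓕_v) =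
⊕_{π} ⊗_α K_{v_α}`). [claim: Mochizuki2012, status: disputed] -/
abbrev Portion (q : RatPlace) : Type := A → Packet F q

/-- The datum (carrier `⊗_α F_{v_α}` / `⊗_{α,ℝ}ℂ`, admissible regions, `μ^log`, label actions, shifts) of the
portion `π` of the `A`-packet at `v_ℚ` — the companion's `archPortion` at `v_ℚ = ∞`, `nonarchPortion` at
`v_ℚ = p`. [claim: Mochizuki2012, status: disputed] -/
def portionDatum : (q : RatPlace) → Portion F A q → CapsuleDatum F A
  | Sum.inl (), π => archPortion F A (fun α => packetInftyEquiv F (π α))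
  | Sum.inr p, π =>
      haveI : Fact (p : ℕ).Prime := ⟨p.2⟩
      nonarchPortion F A p (fun α => packetPrimeEquiv F p (π α))

/-- The portion datum at `∞` (definitional). [claim: Mochizuki2012, status: disputed] -/
theorem portionDatum_infty (π : Portion F A RatPlace.infty) :
    portionDatum F A RatPlace.infty π = archPortion F A (fun α => packetInftyEquiv F (π α)) := rfl

/-- The portion datum at `p` (definitional; any `Fact p.Prime` instance). [claim: Mochizuki2012, status: disputed] -/
theorem portionDatum_prime (p : Nat.Primes) [Fact (p : ℕ).Prime] (π : Portion F A (RatPlace.prime p)) :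
    portionDatum F A (RatPlace.prime p) π = nonarchPortion F A p (fun α => packetPrimeEquiv F p (π α)) := rfl

/-- **The shift of the portion `π` under `f` on the label `α` is the per-place log-modulus `θ_{π(α)}(f)`**
(`log|f|_{w_α}` resp. `(1/n_{v_α})·log‖f‖_{v_α}`). [claim: Mochizuki2012, status: disputed] -/
theorem portionDatum_shift (q : RatPlace) (π : Portion F A q) (α : A) (f : Fˣ) :
    (portionDatum F A q π).shift α f = placeLogModulus F f (π α).1 := by
  rcases q with ⟨⟩ | p
  · show Real.log ((packetInftyEquiv F (π α)) (f : F)) = placeLogModulus F f (π α).1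
    generalize π α = v
    rcases v with ⟨w | w, h⟩
    · rfl
    · exact absurd h (ratPlaceBelow_inr_ne_infty F w)
  · haveI : Fact (p : ℕ).Prime := ⟨p.2⟩
    rw [portionDatum_prime, nonarchPortion_shift]
    generalize π α = v
    rcases v with ⟨w | w, h⟩
    · exact absurd h (ratPlaceBelow_inl_ne_prime F w p)
    · rfl

/-- **The weight of the portion `π = (v_α)_α`**: `∏_α placeProbWeight F v_α` (Remark 3.1.1 (ii)'s normalized weight
of the portion times the dimension of the portion, see `portionWeight_prime_eq_packetWeightTensor_mul`).
[claim: Mochizuki2012, status: disputed] -/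
def portionWeight (q : RatPlace) (π : Portion F A q) : ℝ := ∏ α, placeProbWeight F (π α).1

/-- **[IUTchIII] Prop. 3.9 (i) datum `μ^log_{A,v_ℚ}` at the genuine model**: a region of the `A`-packet at `v_ℚ`
is a family `T = (T_π)_π`, over the portions `π = (v_α)_α`, of admissible subsets `T_π ⊆ ⊗_α F_{v_α}` (resp.
`⊆ ⊗_{α,ℝ}ℂ`) — the direct-product region `∏_π T_π ⊆ ⊕_π ⊗_α K_{v_α} = log(^A𝓕_{v_ℚ})` —, and
`μ^log_{A,v_ℚ}(T) := Σ_π portionWeight(π)·μ^log_π(T_π)`: "the [p-adic / radial] log-volume on each of the direct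
summand … fields … together with the … normalized weights". [claim: Mochizuki2012, status: disputed] -/
def capsulePacketLogVolume (q : RatPlace) (T : ∀ π : Portion F A q, (portionDatum F A q π).Adm) : ℝ :=
  ∑ π : Portion F A q, portionWeight F A q π * (portionDatum F A q π).logVol (T π).1

/-- The change of `μ^log_{A,v_ℚ}` under `f ∈ F^×` acting on the label `α`:
`Σ_π portionWeight(π)·shift_π(α, f)`. [claim: Mochizuki2012, status: disputed] -/
def capsulePacketLogModulus (α : A) (f : Fˣ) (q : RatPlace) : ℝ :=
  ∑ π : Portion F A q, portionWeight F A q π * (portionDatum F A q π).shift α f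

/-- `μ^log_{A,v_ℚ}(f·_α T) = μ^log_{A,v_ℚ}(T) + capsulePacketLogModulus α f v_ℚ` (the per-portion laws
`tensorLogVolume_iota_smul` / `packetLogVol_image_tprod_mul`, summed with the weights).
[claim: Mochizuki2012, status: disputed] -/
theorem capsulePacketLogVolume_actAdm (α : A) (f : Fˣ) (q : RatPlace) (T : ∀ π : Portion F A q, (portionDatum F A q π).Adm) :
    capsulePacketLogVolume F A q (fun π => (portionDatum F A q π).actAdm α f (T π)) =
      capsulePacketLogVolume F A q T + capsulePacketLogModulus F A α f q := by
  simp only [capsulePacketLogVolume, capsulePacketLogModulus, CapsuleDatum.logVol_actAdm, mul_add, Finset.sum_add_distrib]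

/-- **LABEL-ADDITIVITY / the `|A| = 1` reduction**: the change of `μ^log_{A,v_ℚ}` under `f` on ANY label `α` equals
p415871's `|A| = 1` change `packetLogModulus F f v_ℚ = Σ_{v|v_ℚ} c_v·log‖f‖_v` — for every finite label set `A`
(`Σ_π (∏_β ω(π β))·θ_{π α}(f) = Σ_v ω_v·θ_v(f)` since `Σ ω = 1` per packet, and `ω_v·θ_v(f) = c_v·log‖f‖_v`).
This is abc-iut-w4-d035's d035-F1 / abc-iut-L6-d3's `capsuleLogVolume₁` additivity at the GENUINE tensor packets.
[claim: Mochizuki2012, status: disputed] -/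
theorem capsulePacketLogModulus_eq_packetLogModulus (α : A) (f : Fˣ) (q : RatPlace) :
    capsulePacketLogModulus F A α f q = packetLogModulus F f q := by
  unfold capsulePacketLogModulus portionWeight
  simp_rw [portionDatum_shift]
  rw [sum_pi_prod_mul_apply A (fun v : Packet F q => placeProbWeight F v.1) (fun v => placeLogModulus F f v.1)
    (sum_packet_placeProbWeight F q) α]
  unfold packetLogModulus
  exact Finset.sum_congr rfl fun v _ => placeProbWeight_mul_placeLogModulus F f v.1

/-- As functions of `v_ℚ`: `capsulePacketLogModulus F A α f = packetLogModulus F f`. [claim: Mochizuki2012, status: disputed] -/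
theorem capsulePacketLogModulus_eq (α : A) (f : Fˣ) : capsulePacketLogModulus F A α f = packetLogModulus F f :=
  funext (capsulePacketLogModulus_eq_packetLogModulus F A α f)

/-- Hence the changes are finitely supported on `𝕍_ℚ` … [claim: Mochizuki2012, status: disputed] -/
theorem finite_support_capsulePacketLogModulus (α : A) (f : Fˣ) :
    (Function.support (capsulePacketLogModulus F A α f)).Finite := by
  rw [capsulePacketLogModulus_eq]
  exact finite_support_packetLogModulus F f

/-- … and sum to zero over `𝕍_ℚ` — **the product formula** (p415871 `finsum_packetLogModulus_eq_zero`, the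
logarithm of Mathlib's `NumberField.prod_abs_eq_one`, regrouped by rational places).
[claim: Mochizuki2012, status: disputed] -/
theorem finsum_capsulePacketLogModulus_eq_zero (α : A) (f : Fˣ) : ∑ᶠ q, capsulePacketLogModulus F A α f q = 0 := by
  rw [capsulePacketLogModulus_eq]
  exact finsum_packetLogModulus_eq_zero F f

/-! ### The global log-volume `μ^log_{A,𝕍_ℚ}` and its invariance -/

/-- **[IUTchIII] Prop. 3.9 (iii) "multiplication by elements of `(†𝕄⊛_mod)_α`" at the genuine `A`-packets**:
`f ∈ F^×` acts on a global region `(T_{v_ℚ,π})` through the label `α` (`1 ⊗ ⋯ ⊗ f ⊗ ⋯ ⊗ 1` on every portion at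
every `v_ℚ`); the result is again a global region ("zero log-volume for all but finitely many `v_ℚ`" is
preserved: `‖f‖_v = 1` for almost all `v`). [claim: Mochizuki2012, status: disputed] -/
def capsulePacketAction (α : A) (f : Fˣ) (S : GlobalRegion (capsulePacketLogVolume F A)) :
    GlobalRegion (capsulePacketLogVolume F A) :=
  ⟨fun q π => (portionDatum F A q π).actAdm α f (S.1 q π), by
    refine (S.2.union (finite_support_capsulePacketLogModulus F A α f)).subset fun q hq => ?_
    by_contra hq'
    rw [Set.mem_union, not_or, Function.notMem_support, Function.notMem_support] at hq'
    apply Function.mem_support.mp hq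
    change capsulePacketLogVolume F A q (fun π => (portionDatum F A q π).actAdm α f (S.1 q π)) = 0
    rw [capsulePacketLogVolume_actAdm, hq'.1, hq'.2, add_zero]⟩

/-- Components of `f·_α S`. [claim: Mochizuki2012, status: disputed] -/
@[simp] theorem capsulePacketAction_apply (α : A) (f : Fˣ) (S : GlobalRegion (capsulePacketLogVolume F A))
    (q : RatPlace) (π : Portion F A q) :
    (capsulePacketAction F A α f S).1 q π = (portionDatum F A q π).actAdm α f (S.1 q π) := rfl

/-- **IUTchIII:Prop3.9(iii)** (kurims p. 117) INVARIANCE CLAUSE AT THE GENUINE MODEL FOR EVERY CAPSULE `A` AND EVERY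
LABEL `α ∈ A`: `Prop39iii_invariance (capsulePacketLogVolume F A) (capsulePacketAction F A α)` HOLDS — "a global
log-volume `μ^log_{A,𝕍_ℚ}` … which is invariant with respect to multiplication by elements of `(†𝕄⊛_mod)_α`", for
the printed `A`-packets `⊕_{(v_α)} ⊗_α F_{v_α}` (resp. `⊗_{α,ℝ}ℂ`) with their Haar log-volumes and the weights of
Remark 3.1.1 (ii): abc-iut-L6-t5's `Prop39iii_invariance_of_productFormula` fed with the local law
(`capsulePacketLogVolume_actAdm`) and the product formula (`finsum_capsulePacketLogModulus_eq_zero`). Extends p415871's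
`prop39iii_invariance_haarModel` (`|A| = 1`) to all `A`. [claim: Mochizuki2012, status: disputed] -/
theorem prop39iii_invariance_haarModelCapsules_general (α : A) :
    Prop39iii_invariance (capsulePacketLogVolume F A) (capsulePacketAction F A α) :=
  Prop39iii_invariance_of_productFormula (capsulePacketLogVolume F A) (capsulePacketAction F A α)
    (capsulePacketLogModulus F A α) (finite_support_capsulePacketLogModulus F A α) (finsum_capsulePacketLogModulus_eq_zero F A α)
    (fun f S q => capsulePacketLogVolume_actAdm F A α f q (S.1 q))

/-- The invariance unfolded: `μ^log_{A,𝕍_ℚ}(f·_α S) = μ^log_{A,𝕍_ℚ}(S)` for every label `α`, every `f ∈ F^×` and every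
global region `S`. [claim: Mochizuki2012, status: disputed] -/
theorem globalLogVolume_capsulePacketAction (α : A) (f : Fˣ) (S : GlobalRegion (capsulePacketLogVolume F A)) :
    globalLogVolume (capsulePacketLogVolume F A) (capsulePacketAction F A α f S) =
      globalLogVolume (capsulePacketLogVolume F A) S :=
  prop39iii_invariance_haarModelCapsules_general F A α f S

/-- Acting on two different labels `α, β` by `f` and `g` still preserves the global log-volume (the printed
"elements of `(†𝕄⊛_mod)_α`" for the various `α ∈ A` generate a commutative action, invariance label by label).
[claim: Mochizuki2012, status: disputed] -/
theorem globalLogVolume_capsulePacketAction_two (α β : A) (f g : Fˣ)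
    (S : GlobalRegion (capsulePacketLogVolume F A)) :
    globalLogVolume (capsulePacketLogVolume F A) (capsulePacketAction F A α f (capsulePacketAction F A β g S)) =
      globalLogVolume (capsulePacketLogVolume F A) S := by
  rw [globalLogVolume_capsulePacketAction, globalLogVolume_capsulePacketAction]

/-! ### Junction with the printed weights of Remark 3.1.1 (ii) -/

/-- The local degrees `n_v = e_v f_v` over `p` as positive integers — the input `degF = [(F_mod)_w:ℚ_p]` of
abc-iut-L6-t4's `packetWeight`/`packetWeightTensor`. [claim: Mochizuki2012, status: disputed] -/
def localDegreePNat (p : Nat.Primes) (v : {v : HeightOneSpectrum (𝓞 F) // v ∈ placesOver F (p : ℕ)}) : ℕ+ :=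
  ⟨localDegree F v.1, localDegree_pos F v.1⟩

/-- `localDegreePNat` is `n_v`. [claim: Mochizuki2012, status: disputed] -/
@[simp] theorem localDegreePNat_coe (p : Nat.Primes) (v : {v : HeightOneSpectrum (𝓞 F) // v ∈ placesOver F (p : ℕ)}) :
    ((localDegreePNat F p v : ℕ) : ℝ) = localDegree F v.1 := rfl

omit [Nonempty A] in
/-- **The portion weight at `p` IS Remark 3.1.1 (ii)'s normalized weight times the dimension of the portion**:
for `π = (v_α)_α` over `p`, `∏_α n_{v_α}/[F:ℚ] = packetWeightTensor(π) · ∏_α n_{v_α}` with abc-iut-L6-t4's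
`packetWeightTensor degF degKF π = 1/((∏_α degKF(v_α))·Σ_{(w_α)}∏_α degF(w_α))` at `degF = n = e·f` (the local
degrees `[(F_mod)_w:ℚ_p]`) and `degKF = 1` (`K = F_mod`): since `Σ_{(w_α)}∏_α n_{w_α} = (Σ_w n_w)^{|A|} =
[F:ℚ]^{|A|}` (`sum_prod_degF_eq_pow`, `sum_localDegree`). So `portionWeight · tensorLogVolume` (the companion's
dimension-normalised `μ^log`) is, portion by portion, the PRINTED weight times the PRINTED (un-normalised) sum of
the log-volumes of the direct-summand fields. [claim: Mochizuki2012, status: disputed] -/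
theorem portionWeight_prime_eq_packetWeightTensor_mul (p : Nat.Primes) (π : Portion F A (RatPlace.prime p)) :
    portionWeight F A (RatPlace.prime p) π =
      packetWeightTensor (localDegreePNat F p) (fun _ => 1) (fun α => packetPrimeEquiv F p (π α)) *
        ∏ α, (localDegree F (packetPrimeEquiv F p (π α)).1 : ℝ) := by
  haveI : Fact (p : ℕ).Prime := ⟨p.2⟩
  have hd : (Module.finrank ℚ F : ℝ) ≠ 0 := (FinDivisor.finrank_pos (F := F)).ne'
  -- the denominator sum of `packetWeightTensor` is `[F:ℚ]^{|A|}`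
  have hS : (∑ w' : A → {v : HeightOneSpectrum (𝓞 F) // v ∈ placesOver F (p : ℕ)},
      ∏ a, ((localDegreePNat F p (w' a) : ℕ) : ℝ)) = (Module.finrank ℚ F : ℝ) ^ Fintype.card A := by
    rw [sum_prod_degF_eq_pow (localDegreePNat F p)]
    congr 1
    simp only [localDegreePNat_coe]
    rw [Finset.sum_coe_sort (placesOver F (p : ℕ)) (fun v => (localDegree F v : ℝ)), ← Nat.cast_sum,
      sum_localDegree F (p : ℕ)]
  -- each factor of `portionWeight` is `n_{v_α}/[F:ℚ]` with `v_α = packetPrimeEquiv (π α)`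
  have hfac : ∀ α, placeProbWeight F (π α).1 =
      (localDegree F (packetPrimeEquiv F p (π α)).1 : ℝ) / Module.finrank ℚ F := by
    intro α
    generalize π α = v
    rcases v with ⟨w | w, h⟩
    · exact absurd h (ratPlaceBelow_inl_ne_prime F w p)
    · rfl
  unfold portionWeight packetWeightTensor
  simp_rw [hfac]
  rw [hS, Finset.prod_div_distrib, Finset.prod_const, Finset.card_univ]
  simp only [PNat.one_coe, Nat.cast_one, Finset.prod_const_one, one_mul]
  rw [one_div, inv_mul_eq_div]

/-- **Nonarchimedean packet-normalisation for capsules** ([IUTchIII] Prop. 3.9 (i) p. 115, "multiplication of an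
element of "`𝕄(−)`" by `p_v` corresponds to adding the quantity `−log(p_v)`", now for the `A`-packet): multiplying
EVERY portion of a region at `p` by `p` placed in the factor `α` changes `μ^log_{A,p}` by exactly `−log p`, for
every `A` and every `α` (p416627 `packetLogModulus_prime_self`). [claim: Mochizuki2012, status: disputed] -/
theorem capsulePacketLogVolume_prime_natCast (p : Nat.Primes) (α : A)
    (T : ∀ π : Portion F A (RatPlace.prime p), (portionDatum F A (RatPlace.prime p) π).Adm) :
    capsulePacketLogVolume F A (RatPlace.prime p)
        (fun π => (portionDatum F A (RatPlace.prime p) π).actAdm α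
          (Units.mk0 ((p : ℕ) : F) (by exact_mod_cast p.2.ne_zero)) (T π)) =
      capsulePacketLogVolume F A (RatPlace.prime p) T - Real.log p := by
  rw [capsulePacketLogVolume_actAdm, capsulePacketLogModulus_eq_packetLogModulus, packetLogModulus_prime_self, sub_eq_add_neg]

/-- **Archimedean packet-normalisation for capsules** ([IUTchIII] Prop. 3.9 (i) p. 116, "multiplication … by
`e = 2.71828...` corresponds to adding the quantity `1 = log(e)`"): for a natural number `n ≥ 2` placed in the factor
`α` of every portion at `∞`, `μ^log_{A,∞}` changes by `+log n` (p416627 `packetLogModulus_infty_natCast`); the real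
scalar `e` itself is covered portion by portion by campaign-S `packetLogVol_smul` (`+log|c|`) with
`sum_packet_placeProbWeight` (`Σ_π portionWeight(π) = 1`). [claim: Mochizuki2012, status: disputed] -/
theorem capsulePacketLogVolume_infty_natCast (p : Nat.Primes) (α : A)
    (T : ∀ π : Portion F A RatPlace.infty, (portionDatum F A RatPlace.infty π).Adm) :
    capsulePacketLogVolume F A RatPlace.infty
        (fun π => (portionDatum F A RatPlace.infty π).actAdm α
          (Units.mk0 ((p : ℕ) : F) (by exact_mod_cast p.2.ne_zero)) (T π)) =
      capsulePacketLogVolume F A RatPlace.infty T + Real.log p := by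
  rw [capsulePacketLogVolume_actAdm, capsulePacketLogModulus_eq_packetLogModulus, packetLogModulus_infty_natCast]

/-- **The portion weights sum to `1`** at every `v_ℚ` (`Σ_π ∏_α ω(π α) = (Σ_v ω v)^{|A|} = 1`): the packet
normalisation of `μ^log_{A,v_ℚ}` — multiplying every portion by a scalar of log-modulus `c` changes `μ^log_{A,v_ℚ}`
by `c`. [claim: Mochizuki2012, status: disputed] -/
theorem sum_portionWeight (q : RatPlace) : ∑ π : Portion F A q, portionWeight F A q π = 1 := by
  obtain ⟨α⟩ := (inferInstance : Nonempty A)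
  have h := sum_pi_prod_mul_apply A (fun v : Packet F q => placeProbWeight F v.1) (fun _ => (1 : ℝ))
    (sum_packet_placeProbWeight F q) α
  simp only [mul_one, sum_packet_placeProbWeight] at h
  simpa only [portionWeight] using h

end Literature.IUT.LogThetaLattice

end
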